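import Literature.NumberTheory.LFunctions.MertensFirstChainSound
import Mathlib.NumberTheory.ArithmeticFunction.VonMangoldt
import HarnessLib

/-!
# The Mertens remainder on the small range `20 ≤ y < 319` by kernel computation:
# `Σ_{n ≤ y} Λ(n)/n ≤ log y − γ + 9/100` (STUB-PLAN `stub_windowCore`, helper A4)

Crux `WeilComb.CombShapePositivity` (item stmt-RiemannHypothesis-11229), line `Sketch`, STUB-PLAN
`stub_windowCore` Phase A, helper A4 (`SmallRangeTable` of the typed companion
`Cruxes/CombShapePositivity/SketchStubPlanWindowCore.lean`; the plan's advice "use threshold `9/100`",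
the true maximum being `E₁(31) = 0.0864`).

A fixed-point (`2⁸⁰`) checker walks `n = 1, …, 318`, accumulating an upper bound `P ≥ 2⁸⁰ ψ₁(n)`,
`ψ₁(n) = Σ_{k ≤ n} Λ(k)/k` (a prime power `k = pʲ` is recognised by `p = minFac k`, `p^{log_p k} = k`,
and contributes `⌈hi(p)/k⌉` with `hi(p)/2⁸⁰ ≥ log p` from the tree's kernel logarithm `KernelLog.logIv`),
and at every `n ≥ 20` tests `P + Γ⁺ ≤ lo(n) + C` with `Γ⁺ = GAMMAHIN ≥ 2⁸⁰ γ`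
(`MertensFirstChain.le_GAMMAHIN`), `lo(n)/2⁸⁰ ≤ log n` and `C/2⁸⁰ ≤ 9/100`. The run is one
`decide +kernel` (`smallRun_holds`, a fraction of a second of kernel time); its meaning is `smallRun_sound`.

* `sum_vonMangoldt_div_le_small_nat` — `Σ_{k ≤ N} Λ(k)/k ≤ log N − γ + 9/100` for naturals `20 ≤ N ≤ 318`;
* `stub_mertensSmall` (registered on the crux) — the same for real `20 ≤ y < 319`
  (`ψ₁(y) = ψ₁(⌊y⌋)`, `log ⌊y⌋ ≤ log y`).
-/

-- the sub-problem path RiemannHypothesis/RiemannHypothesis duplicates a namespace (D-0017)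
set_option linter.dupNamespace false

open Finset ArithmeticFunction

namespace Summit.RiemannHypothesis.RiemannHypothesis.Theorems.WeilCombMertensSmall

open Literature.NumberTheory.LFunctions Literature.Analysis.SpecialFunctions.KernelLog
open MertensFirstChain (GAMMAHIN le_GAMMAHIN)

/-! ### The checker -/

/-- `⌊(9/100) · 2⁸⁰⌋`. [folklore] -/
def C9 : ℤ := 108803323765316625723555

/-- Upper bound, in units of `2⁻⁸⁰`, for `Λ(n)/n`: `⌈hi(p)/n⌉` if `n = p^j` (`p = minFac n`), else `0`;
`none` if the logarithm enclosure is unavailable. [folklore] -/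
def incr (n : ℕ) : Option ℕ :=
  if 2 ≤ n ∧ n.minFac ^ (Nat.log n.minFac n) = n then
    match logIv n.minFac with
    | some (_, ug) => some ((ug.toNat + n - 1) / n)
    | none => none
  else some 0

/-- The test at `n`: for `n ≥ 20`, `P + GAMMAHIN ≤ lo(n) + C9`. [folklore] -/
def stepOK (n P : ℕ) : Bool :=
  if 20 ≤ n then
    match logIv n with
    | some (lg, _) => decide (((P + GAMMAHIN : ℕ) : ℤ) ≤ lg + C9)
    | none => false
  else true

/-- The run: from the state `(n, P)` (`P ≥ 2⁸⁰ ψ₁(n)`) process `n+1, …, n+fuel`. [folklore] -/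
def smallRun : ℕ → ℕ → ℕ → Bool
  | 0, _, _ => true
  | fuel + 1, n, P =>
    match incr (n + 1) with
    | none => false
    | some d => stepOK (n + 1) (P + d) && smallRun fuel (n + 1) (P + d)

/-- **The certified run over `1 ≤ n ≤ 318`.** [folklore] -/
theorem smallRun_holds : smallRun 318 0 0 = true := by
  decide +kernel

/-! ### Soundness -/

/-- `C9/2⁸⁰ ≤ 9/100`. [folklore] -/
theorem C9_le : (C9 : ℝ) ≤ 9 / 100 * 2 ^ 80 := by norm_num [C9]

/-- `ψ₁(n) = Σ_{k ≤ n} Λ(k)/k` over the naturals (local notation for the soundness proof). [folklore] -/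
noncomputable def psiOneNat (n : ℕ) : ℝ := ∑ k ∈ Finset.Icc 1 n, (Λ k : ℝ) / k

/-- `ψ₁(n+1) = ψ₁(n) + Λ(n+1)/(n+1)`. [folklore] -/
theorem psiOneNat_succ (n : ℕ) :
    psiOneNat (n + 1) = psiOneNat n + (Λ (n + 1) : ℝ) / ((n : ℝ) + 1) := by
  unfold psiOneNat
  rw [Finset.sum_Icc_succ_top (by omega)]
  push_cast
  ring

/-- **Soundness of `incr`**: `incr n = some d → 2⁸⁰ Λ(n)/n ≤ d`. [folklore] -/
theorem incr_sound {n d : ℕ} (h : incr n = some d) : 2 ^ 80 * ((Λ n : ℝ) / n) ≤ d := by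
  unfold incr at h
  split_ifs at h with hcond
  · -- prime-power branch
    obtain ⟨hn2, hpow⟩ := hcond
    have hn0 : (0 : ℝ) < n := by exact_mod_cast (show 0 < n by omega)
    -- Λ n ≤ log (minFac n) in all cases
    have hΛ : (Λ n : ℝ) ≤ Real.log n.minFac := by
      rw [vonMangoldt_apply]
      split_ifs
      · exact le_rfl
      · exact Real.log_nonneg (by exact_mod_cast (Nat.minFac_pos n))
    revert h
    cases hl : logIv n.minFac with
    | none => intro h; exact absurd h (by simp)
    | some lohi =>
      obtain ⟨lo, hi⟩ := lohi
      intro h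
      simp only [Option.some.injEq] at h
      have hs := (logIv_sound hl).2
      -- 2^80 log p ≤ hi ≤ hi.toNat
      have hhi : 2 ^ 80 * Real.log n.minFac ≤ (hi.toNat : ℝ) := by
        have h1 : 2 ^ 80 * Real.log n.minFac ≤ (hi : ℝ) := by
          rw [le_div_iff₀ (by positivity)] at hs; linarith
        have h2 : (hi : ℝ) ≤ ((hi.toNat : ℤ) : ℝ) := by exact_mod_cast Int.self_le_toNat hi
        have h3 : ((hi.toNat : ℤ) : ℝ) = (hi.toNat : ℝ) := by norm_cast
        linarith
      -- ceil division
      have hceil : (hi.toNat : ℝ) / n ≤ (((hi.toNat + n - 1) / n : ℕ) : ℝ) := by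
        rw [div_le_iff₀ hn0]
        have hnat : hi.toNat ≤ (hi.toNat + n - 1) / n * n := by
          set a := hi.toNat with ha
          set q := (a + n - 1) / n with hq
          have h1 : a + n - 1 < q * n + n := by
            have := Nat.lt_div_mul_add (a := a + n - 1) (show 0 < n by omega)
            rwa [← hq] at this
          have hn1 : 1 ≤ n := by omega
          omega
        exact_mod_cast hnat
      rw [← h]
      calc 2 ^ 80 * ((Λ n : ℝ) / n) = 2 ^ 80 * (Λ n : ℝ) / n := by ring
        _ ≤ 2 ^ 80 * Real.log n.minFac / n := by gcongr
        _ ≤ (hi.toNat : ℝ) / n := by gcongr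
        _ ≤ _ := hceil
  · -- not a prime power: Λ n = 0
    simp only [Option.some.injEq] at h
    subst h
    have hΛ : (Λ n : ℝ) = 0 := by
      rw [vonMangoldt_apply]
      split_ifs with hpp
      · exfalso
        apply hcond
        obtain ⟨p, k, hp, hk, rfl⟩ := (isPrimePow_nat_iff _).1 hpp
        have hp' : p.Prime := hp
        refine ⟨?_, ?_⟩
        · calc 2 ≤ p := hp'.two_le
            _ = p ^ 1 := (pow_one p).symm
            _ ≤ p ^ k := Nat.pow_le_pow_right hp'.pos hk
        · rw [hp'.pow_minFac (by omega), Nat.log_pow hp'.one_lt]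
      · rfl
    simp [hΛ]

/-- **Soundness of `stepOK`**: for `n ≥ 20`, `stepOK n P = true` and `2⁸⁰ ψ₁(n) ≤ P` give
`ψ₁(n) ≤ log n − γ + 9/100`. [folklore] -/
theorem stepOK_sound {n P : ℕ} (hn : 20 ≤ n) (h : stepOK n P = true) (hP : 2 ^ 80 * psiOneNat n ≤ P) :
    psiOneNat n ≤ Real.log n - Real.eulerMascheroniConstant + 9 / 100 := by
  unfold stepOK at h
  rw [if_pos hn] at h
  revert h
  cases hl : logIv n with
  | none => simp
  | some lohi =>
    obtain ⟨lo, hi⟩ := lohi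
    intro h
    have hdec : ((P + GAMMAHIN : ℕ) : ℤ) ≤ lo + C9 := of_decide_eq_true h
    have hlo := (logIv_sound hl).1
    have hγ := le_GAMMAHIN
    have hC := C9_le
    have hR : ((P : ℝ) + GAMMAHIN) ≤ (lo : ℝ) + C9 := by
      have : (((P + GAMMAHIN : ℕ) : ℤ) : ℝ) ≤ ((lo + C9 : ℤ) : ℝ) := by exact_mod_cast hdec
      push_cast at this
      exact this
    have hlo' : (lo : ℝ) ≤ 2 ^ 80 * Real.log n := by
      rw [div_le_iff₀ (by positivity)] at hlo; linarith
    -- 2^80 (ψ₁ n + γ) ≤ 2^80 (log n + 9/100)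
    have key : 2 ^ 80 * (psiOneNat n + Real.eulerMascheroniConstant) ≤
        2 ^ 80 * (Real.log n + 9 / 100) := by linarith
    have := le_of_mul_le_mul_left key (by positivity : (0 : ℝ) < 2 ^ 80)
    linarith

/-- **Soundness of the run.** If `smallRun fuel n P = true` and `2⁸⁰ ψ₁(n) ≤ P`, then
`ψ₁(m) ≤ log m − γ + 9/100` for every `m` with `n < m ≤ n + fuel` and `20 ≤ m`. [folklore] -/
theorem smallRun_sound : ∀ (fuel n P : ℕ), smallRun fuel n P = true → 2 ^ 80 * psiOneNat n ≤ P →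
    ∀ m : ℕ, n < m → m ≤ n + fuel → 20 ≤ m →
      psiOneNat m ≤ Real.log m - Real.eulerMascheroniConstant + 9 / 100
  | 0, n, P, _, _, m, h1, h2, _ => by omega
  | fuel + 1, n, P, hrun, hP, m, h1, h2, h20 => by
    unfold smallRun at hrun
    revert hrun
    cases hinc : incr (n + 1) with
    | none => simp
    | some d =>
      intro hrun
      simp only [Bool.and_eq_true] at hrun
      obtain ⟨hstep, hrest⟩ := hrun
      have hP' : 2 ^ 80 * psiOneNat (n + 1) ≤ ((P + d : ℕ) : ℝ) := by
        have hi := incr_sound hinc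
        rw [psiOneNat_succ, mul_add]
        push_cast at hi ⊢
        linarith
      rcases Nat.lt_or_ge (n + 1) m with hlt | hge
      · exact smallRun_sound fuel (n + 1) (P + d) hrest hP' m hlt (by omega) h20
      · have hm : m = n + 1 := by omega
        subst hm
        exact stepOK_sound h20 hstep hP'

/-- **A4, natural form**: `Σ_{k ≤ N} Λ(k)/k ≤ log N − γ + 9/100` for every natural `20 ≤ N ≤ 318`
(kernel computation; the maximum of the left side minus `log N − γ` is `0.0864…` at `N = 31`). [folklore] -/
theorem sum_vonMangoldt_div_le_small_nat {N : ℕ} (h20 : 20 ≤ N) (h318 : N ≤ 318) :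
    ∑ k ∈ Finset.Icc 1 N, (Λ k : ℝ) / k ≤ Real.log N - Real.eulerMascheroniConstant + 9 / 100 := by
  have h0 : 2 ^ 80 * psiOneNat 0 ≤ ((0 : ℕ) : ℝ) := by simp [psiOneNat]
  exact smallRun_sound 318 0 0 smallRun_holds h0 N (by omega) (by omega) h20

/-- **Stub `stub_mertensSmall` (STUB-PLAN `stub_windowCore`, helper A4; registered on crux
stmt-RiemannHypothesis-11229)**: for real `20 ≤ y < 319`, `Σ_{n ≤ y} Λ(n)/n ≤ log y − γ + 9/100`.
[folklore] -/
theorem stub_mertensSmall : ∀ y : ℝ, 20 ≤ y → y < 319 →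
    ∑ n ∈ Finset.Icc 1 ⌊y⌋₊, (ArithmeticFunction.vonMangoldt n : ℝ) / n ≤
      Real.log y - Real.eulerMascheroniConstant + 9 / 100 := by
  intro y hy hy'
  have hy0 : 0 ≤ y := by linarith
  have hN20 : 20 ≤ ⌊y⌋₊ := Nat.le_floor (by exact_mod_cast hy)
  have hN318 : ⌊y⌋₊ ≤ 318 := by
    have : ⌊y⌋₊ < 319 := (Nat.floor_lt hy0).2 (by exact_mod_cast hy')
    omega
  have h := sum_vonMangoldt_div_le_small_nat hN20 hN318
  have hlog : Real.log (⌊y⌋₊ : ℝ) ≤ Real.log y :=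
    Real.log_le_log (by exact_mod_cast (show 0 < ⌊y⌋₊ by omega)) (Nat.floor_le hy0)
  linarith

end Summit.RiemannHypothesis.RiemannHypothesis.Theorems.WeilCombMertensSmall
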